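import Summits.ResolutionOfSingularities.ResolutionOfSingularities.Theorems.SectionAscentFibrewiseClosedPointsTraceIdealReduction
import Summits.ResolutionOfSingularities.ResolutionOfSingularities.Theorems.FibrewiseClosedPoints.Negative.LoadBearing
import Summits.ResolutionOfSingularities.ResolutionOfSingularities.Theorems.SectionAscentFibrewiseClosedPointsOneShotCurves
import Literature.AlgebraicGeometry.Resolution.AffineDomainDimension
import HarnessLib

/-!
# Crux `FibrewiseClosedPoints` (stmt-ResolutionOfSingularities-15960) — line `dimension-ladder`
# (forward generator G4 `ladder-down`, unit fwd-ladder-ResolutionOfSingularities-52, 2026-08-17)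

The crux `SectionAscent.FibrewiseClosedPoints` is, by the kernel facts
`Negative.LoadBearing.fibrewiseClosedPoints_iff_oneShotAffine` / `…_iff_forall_succ`, the statement
"for every prime `p`, every field `K` of characteristic `p` and every integral affine `K`-variety
`Spec A` (EVERY dimension) there is `I ≠ 0` with `Bl_I(Spec A)` regular and `V(I) = Sing(Spec A)`
exactly" — strong exact-centre one-shot resolution of affine varieties.  It is graded by ONE natural
parameter, the dimension `n = dim A`:

* `Rung n` — the level-`n` statement (exact dimension `n`, all `p`, all `K` of characteristic `p`);
  the crux is `∀ n, Rung n` (`rung_of_crux`, `FibrewiseClosedPoints_of`).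
* FLOOR (proved rungs): `n ≤ 1` unconditionally in the tree (`OneShotCurves.stub_oneShotCurves`:
  conductor blow-up); `n = 3` in the kernel from the two results in print vendored as the named facts
  `CossartPiltant2019AffineOneBlowup` (CP 2019 Thm 1.1 affine ⊕ Liu 8.1.24) and
  `CossartPiltant2019Principalization` (CP 2019 Prop. 4.3 of arXiv v1) —
  `TraceIdeal.oneShotBody_three_of_facts` (re-centering / trace-ideal untwist, `ExactCentre.md`);
  `n = 2` from the same (R)-fact and principalization of ideals on regular surfaces (Zariski 1939 /
  Lipman 1969; in print, stub `stub_surfacePrincipalization`).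
* THE RUNG (next, open): `AffineFourfolds := Rung 4` — exact-centre one-shot resolution of
  four-dimensional affine domains over fields of characteristic `p`.  By the dimension-free
  re-centering theorem `TraceIdeal.exists_oneShot_of_principalizationAt` it follows
  (`affineFourfolds_of`, PROVED here) from its two standard cores one dimension above print:
  `stub_strongResolutionFourfolds` (R₄ = CP Thm 1.1 for affine fourfolds, blow-up form) and
  `stub_principalizationFourfolds` (P₄ = CP Prop. 4.3 on regular fourfolds, i.e. embedded
  resolution / principalization of ideals with cosupport of dimension ≤ 3).
* THE GAP above the rung, declared honestly as ONE stub: `stub_dimensionFiveAndUp : ∀ n ≥ 5, Rung n`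
  (by `rungAt_of_strongBlowupForm_of_principalization` it splits level-wise as Rₙ ∧ Pₙ).

Stubs (sorries ONLY here): `stub_printedThreefolds` (the two named Literature facts, in print),
`stub_surfacePrincipalization` (in print), `stub_strongResolutionFourfolds`, `stub_principalizationFourfolds`
(the rung's open cores), `stub_dimensionFiveAndUp` (gap).  Everything else is proved, and
`FibrewiseClosedPoints_of` concludes the crux BY NAME.

Sources: [CossartPiltant2019] Thm 1.1, p. 3, Rem. 3.2, Prop. 4.3 (v1); [Liu2002] Thm 8.1.24;
[Lipman1978]; [Zariski1939]/[Lipman1969] (complete ideals, principalization on regular surfaces);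
[CutkoskyMourtada2019] §1, [Cutkosky2009] §1, [Piltant2013] §1 (patching ceiling dim 3);
Schober arXiv:1708.04784 p. 3 ("resolution in dimension four and higher … remain very difficult");
`Literature/Barriers/ResolutionOfSingularities/DimensionFourFrontier.lean`.
-/

noncomputable section

set_option linter.dupNamespace false

open AlgebraicGeometry CategoryTheory Literature.AlgebraicGeometry.Resolution
open Summit.ResolutionOfSingularities.ResolutionOfSingularities.Theses.SectionAscent
open Summit.ResolutionOfSingularities.ResolutionOfSingularities.Theorems.SectionAscent.TraceIdeal
open Summit.ResolutionOfSingularities.ResolutionOfSingularities.Theorems.SectionAscent.OneShotCurves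
open Summit.ResolutionOfSingularities.ResolutionOfSingularities.Theorems.FibrewiseClosedPoints.Negative

namespace Summit.ResolutionOfSingularities.ResolutionOfSingularities.Cruxes.FibrewiseClosedPoints.DimensionLadder

/-! ## The graded family -/

/-- **Level `n` of the dimension ladder at the field `K`**: every `n`-dimensional domain `A` of
finite type over `K` has a non-zero ideal `I` with `Bl_I(Spec A)` regular and `V(I) = Sing(Spec A)`
exactly (the crux's `OneShot` body, verbatim, at exact dimension `n`). [folklore] -/
def RungAt (K : Type) [Field K] (n : ℕ) : Prop :=
  ∀ (A : Type) [CommRing A] [IsDomain A] [Algebra K A] [Algebra.FiniteType K A],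
    ringKrullDim A = n → ∃ I : Ideal A, I ≠ ⊥ ∧ Scheme.IsRegular (affineBlowup I) ∧
      ∀ 𝔭 : PrimeSpectrum A, I ≤ 𝔭.asIdeal ↔ ¬ IsRegularLocalRing (Localization.AtPrime 𝔭.asIdeal)

/-- **`Rung n`** — level `n` of the ladder: `RungAt K n` for every prime `p` and every field `K` of
characteristic `p`.  The crux is `∀ n, Rung n` (`rung_of_crux`, `FibrewiseClosedPoints_of`). [folklore] -/
def Rung (n : ℕ) : Prop :=
  ∀ p : ℕ, p.Prime → ∀ (K : Type) [Field K] [CharP K p], RungAt K n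

/-- **THE RUNG: affine fourfolds.** Exact-centre one-shot resolution of four-dimensional integral
affine varieties over fields of positive characteristic — the first level of the crux not settled
in print (Cossart–Piltant 2019 stop at dimension three; Schober 2018 p. 3).
[cite: CossartPiltant2019, §1 and Rem. 3.2] -/
def AffineFourfolds : Prop := Rung 4

/-- **(Rₙ) strong resolution in blow-up form at level `n` over `K`**: every `n`-dimensional affine
domain of finite type over `K` has `J ≠ 0` with `Bl_J(Spec A)` regular and `Bl_J → Spec A` an
isomorphism over `Reg(Spec A)` (the shape of `CossartPiltant2019AffineOneBlowup`, which is `n ≤ 3`).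
[cite: CossartPiltant2019, Thm. 1.1] -/
def StrongBlowupFormDim (K : Type) [Field K] (n : ℕ) : Prop :=
  ∀ (A : Type) [CommRing A] [IsDomain A] [Algebra K A] [Algebra.FiniteType K A],
    ringKrullDim A = n → ∃ J : Ideal A, J ≠ ⊥ ∧ Scheme.IsRegular (affineBlowup J) ∧
      ∃ U : (Spec (.of A)).Opens,
        (U : Set (Spec (.of A))) = {x | IsRegularLocalRing (Localization.AtPrime x.asIdeal)} ∧
        IsIso (affineBlowup.π J ∣_ U)

/-- **(Pₙ) principalization at level `n` over `K`**: on every regular integral `n`-dimensional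
`K`-variety `S`, every non-zero ideal sheaf is principalized by a sequence of blowings up in regular
centres inside its non-principal locus (the shape of `CossartPiltant2019Principalization`, which is
`n = 3`). [cite: CossartPiltant2019, Prop. 4.3 (arXiv v1)] -/
def PrincipalizationDim (K : Type) [Field K] (n : ℕ) : Prop :=
  ∀ (S : Scheme.{0}) [IsIntegral S] (f : S ⟶ Spec (.of K)) [LocallyOfFiniteType f] [QuasiCompact f],
    Scheme.IsRegular S → topologicalKrullDim S = n → ∀ M : S.IdealSheafData, M ≠ ⊥ →
      ∃ (S' : Scheme.{0}) (σ : S' ⟶ S), IsRegularCentreBlowupSeq σ M ∧ IsLocallyPrincipal (M.comap σ)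

/-! ## The stubs (sorries live only here) -/

/-- STUB (in print, vendored): the two named Literature facts of the floor — Cossart–Piltant 2019
Thm 1.1 for affine schemes of dimension `≤ 3` in blow-up form (with Liu 2002 Thm 8.1.24) and their
principalization Prop. 4.3 on regular excellent threefolds.
[cite: CossartPiltant2019, Thm. 1.1 and Prop. 4.3 (arXiv v1)] -/
theorem stub_printedThreefolds :
    CossartPiltant2019AffineOneBlowup.{0} ∧ CossartPiltant2019Principalization.{0} := by
  sorry

/-- STUB (in print): **principalization of ideals on regular surfaces** — on a regular integral
surface of finite type over a field, every non-zero ideal sheaf becomes invertible after finitely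
many blowings up of closed points of its non-principal locus (Zariski's factorization of complete
ideals; Lipman 1969 §§1–2; CJS 2020 for excellent surfaces). [cite: Lipman1978, §1] -/
theorem stub_surfacePrincipalization : ∀ (K : Type) [Field K], PrincipalizationDim K 2 := by
  sorry

/-- STUB (OPEN — rung core R₄): **strong resolution of affine fourfolds in blow-up form** — for every
prime `p`, field `K` of characteristic `p` and four-dimensional domain `A` of finite type over `K`,
some `J ≠ 0` has `Bl_J(Spec A)` regular with `Bl_J → Spec A` an isomorphism over `Reg(Spec A)`
(Cossart–Piltant's Theorem 1.1 one dimension up; open, CP 2019 §1, Rem. 3.2).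
[cite: CossartPiltant2019, Thm. 1.1 and Rem. 3.2] -/
theorem stub_strongResolutionFourfolds :
    ∀ p : ℕ, p.Prime → ∀ (K : Type) [Field K] [CharP K p], StrongBlowupFormDim K 4 := by
  sorry

/-- STUB (OPEN — rung core P₄): **principalization on regular fourfolds** — for every prime `p` and
field `K` of characteristic `p`, non-zero ideal sheaves on regular integral four-dimensional
`K`-varieties are principalized by blowing up regular centres in their non-principal loci
(Cossart–Piltant's Prop. 4.3 one dimension up: it needs embedded resolution of the cosupport, of
dimension `≤ 3`, inside a regular fourfold — open). [cite: CossartPiltant2019, Prop. 4.3 (arXiv v1) and §1] -/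
theorem stub_principalizationFourfolds :
    ∀ p : ℕ, p.Prime → ∀ (K : Type) [Field K] [CharP K p], PrincipalizationDim K 4 := by
  sorry

/-- STUB (GAP above the rung, declared honestly; not a work target of this line): the ladder from
dimension five up — by `rungAt_of_strongBlowupForm_of_principalization` each level `n` follows from
(Rₙ) and (Pₙ). [cite: CossartPiltant2019, §1] -/
theorem stub_dimensionFiveAndUp : ∀ n : ℕ, 5 ≤ n → Rung n := by
  sorry

/-! ## Proved: the re-centering step at every level -/

/-- `Bl_J(Spec A)` has dimension `n` when `A` is an `n`-dimensional domain of finite type over a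
field and `J ≠ 0` (read on the dense open `π⁻¹ D(a) ≅ D(a)`, `0 ≠ a ∈ J`).
[cite: GortzWedhorn2020, Thm. 5.22 (3)] -/
theorem topologicalKrullDim_affineBlowup (K : Type) {A : Type} [Field K] [CommRing A] [IsDomain A]
    [Algebra K A] [Algebra.FiniteType K A] (J : Ideal A) (hJ : J ≠ ⊥) (n : ℕ)
    (hdim : ringKrullDim A = n) : topologicalKrullDim (affineBlowup J) = n := by
  haveI : IsNoetherianRing A := Algebra.FiniteType.isNoetherianRing K A
  haveI : IsIntegral (affineBlowup J) := affineBlowup.isIntegral hJ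
  let g : Spec (.of A) ⟶ Spec (.of K) := Spec.map (CommRingCat.ofHom (algebraMap K A))
  haveI : LocallyOfFiniteType g :=
    (HasRingHomProperty.Spec_iff (P := @LocallyOfFiniteType)).mpr
      (RingHom.finiteType_algebraMap.mpr ‹Algebra.FiniteType K A›)
  let f : affineBlowup J ⟶ Spec (.of K) := affineBlowup.π J ≫ g
  haveI : LocallyOfFiniteType f := inferInstance
  obtain ⟨a, haJ, ha0⟩ := J.ne_bot_iff.mp hJ
  haveI : IsDomain (Localization.Away a) :=
    IsLocalization.isDomain_localization (powers_le_nonZeroDivisors_of_noZeroDivisors ha0)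
  haveI : Nonempty (Spec (.of (Localization.Away a))) :=
    ⟨(⟨⊥, Ideal.isPrime_bot⟩ : PrimeSpectrum (Localization.Away a))⟩
  have h1 := topologicalKrullDim_eq_of_isOpenImmersion f (affineBlowup.awayι a haJ)
  have h2 := topologicalKrullDim_eq_of_isOpenImmersion g (affineBlowup.awayι a haJ ≫ affineBlowup.π J)
  rw [← h1, h2]
  change topologicalKrullDim (PrimeSpectrum A) = n
  rw [PrimeSpectrum.topologicalKrullDim_eq_ringKrullDim, hdim]

/-- **Re-centering at level `n` (PROVED): (Rₙ) → (Pₙ) → `RungAt K n`.**  Given `J` with `Bl_J`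
regular and an isomorphism over `Reg` (so `J` is principal at regular points,
`isPrincipal_map_of_isIso_morphismRestrict`) and principalization on the regular `n`-dimensional
`K`-variety `Bl_J(Spec A)`, the dimension-free untwist `exists_oneShot_of_principalizationAt`
produces `I ≠ 0` with `Bl_I` regular and `V(I) = Sing` exactly. [cite: KollarWitaszek2021, Thm. 1] -/
theorem rungAt_of_strongBlowupForm_of_principalization (K : Type) [Field K] (n : ℕ)
    (hR : StrongBlowupFormDim K n) (hP : PrincipalizationDim K n) : RungAt K n := by
  intro A _ _ _ _ hdim
  haveI : IsNoetherianRing A := Algebra.FiniteType.isNoetherianRing K A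
  obtain ⟨J, hJ, hreg, U, hU, hiso⟩ := hR A hdim
  obtain ⟨a, haJ, ha0⟩ := J.ne_bot_iff.mp hJ
  haveI := hiso
  have hprin : ∀ 𝔭 : PrimeSpectrum A, IsRegularLocalRing (Localization.AtPrime 𝔭.asIdeal) →
      (J.map (algebraMap A (Localization.AtPrime 𝔭.asIdeal))).IsPrincipal := fun 𝔭 h𝔭 =>
    isPrincipal_map_of_isIso_morphismRestrict J U 𝔭 (by rw [← SetLike.mem_coe, hU]; exact h𝔭)
  haveI : IsIntegral (affineBlowup J) := affineBlowup.isIntegral hJ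
  haveI : IsNoetherian (affineBlowup J) := isNoetherian_affineBlowup J
  let g : Spec (.of A) ⟶ Spec (.of K) := Spec.map (CommRingCat.ofHom (algebraMap K A))
  haveI : LocallyOfFiniteType g :=
    (HasRingHomProperty.Spec_iff (P := @LocallyOfFiniteType)).mpr
      (RingHom.finiteType_algebraMap.mpr ‹Algebra.FiniteType K A›)
  let f : affineBlowup J ⟶ Spec (.of K) := affineBlowup.π J ≫ g
  haveI : LocallyOfFiniteType f := inferInstance
  haveI : QuasiCompact f := inferInstance
  have hdimBl : topologicalKrullDim (affineBlowup J) = n := topologicalKrullDim_affineBlowup K J hJ n hdim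
  exact exists_oneShot_of_principalizationAt J haJ ha0 hreg hprin (hP (affineBlowup J) f hreg hdimBl)

/-! ## Proved: the floor (levels `≤ 3`) and the rung from its cores -/

/-- **(R_n) for `n ≤ 3` is the named fact `CossartPiltant2019AffineOneBlowup`.**
[cite: CossartPiltant2019, Thm. 1.1] -/
theorem strongBlowupFormDim_of_le_three (h : CossartPiltant2019AffineOneBlowup.{0}) (K : Type) [Field K]
    (n : ℕ) (hn : n ≤ 3) : StrongBlowupFormDim K n := by
  intro A _ _ _ _ hdim
  have hle : ringKrullDim A ≤ 3 := by
    rw [hdim]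
    exact_mod_cast hn
  exact h K A hle

/-- **The floor: `Rung n` for every `n ≤ 3`** — `n ≤ 1` unconditional (conductor blow-up,
`stub_oneShotCurves`), `n = 2` by re-centering from (R≤3) and surface principalization, `n = 3` the
landed `oneShotBody_three_of_facts`. [cite: CossartPiltant2019, Thm. 1.1, p. 3 and Prop. 4.3 (arXiv v1)] -/
theorem rung_of_le_three (h3 : CossartPiltant2019AffineOneBlowup.{0} ∧ CossartPiltant2019Principalization.{0})
    (hP2 : ∀ (K : Type) [Field K], PrincipalizationDim K 2) (n : ℕ) (hn : n ≤ 3) : Rung n := by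
  intro p hp K _ _ A _ _ _ _ hdim
  interval_cases n
  · exact stub_oneShotCurves p hp K A (by rw [hdim]; exact_mod_cast (show (0 : ℕ) < 2 by norm_num))
  · exact stub_oneShotCurves p hp K A (by rw [hdim]; exact_mod_cast (show (1 : ℕ) < 2 by norm_num))
  · exact rungAt_of_strongBlowupForm_of_principalization K 2
      (strongBlowupFormDim_of_le_three h3.1 K 2 (by norm_num)) (hP2 K) A hdim
  · exact oneShotBody_three_of_facts h3.1 h3.2 K A (by exact_mod_cast hdim)

/-- **The floor in the rung's own shape: `Rung 3` from the two named facts in print** (the special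
case `θ₀ = 3` of the graded family). [cite: CossartPiltant2019, Thm. 1.1 and Prop. 4.3 (arXiv v1)] -/
theorem rung_three_of_printedFacts (h : CossartPiltant2019AffineOneBlowup.{0})
    (hP : CossartPiltant2019Principalization.{0}) : Rung 3 :=
  fun _ _ K _ _ A _ _ _ _ hdim => oneShotBody_three_of_facts h hP K A (by exact_mod_cast hdim)

/-- **The rung from its two cores (PROVED): (R₄) → (P₄) → `AffineFourfolds`.**
[cite: KollarWitaszek2021, Thm. 1] -/
theorem affineFourfolds_of
    (hR4 : ∀ p : ℕ, p.Prime → ∀ (K : Type) [Field K] [CharP K p], StrongBlowupFormDim K 4)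
    (hP4 : ∀ p : ℕ, p.Prime → ∀ (K : Type) [Field K] [CharP K p], PrincipalizationDim K 4) :
    AffineFourfolds :=
  fun p hp K _ _ => rungAt_of_strongBlowupForm_of_principalization K 4 (hR4 p hp K) (hP4 p hp K)

/-! ## Proved: on-path — the crux gives every rung -/

/-- **On-path: the crux implies every level of the ladder** (instantiate the target form
`OneShotAffine` at `d = n + 1`). [folklore] -/
theorem rung_of_crux
    (h : Summit.ResolutionOfSingularities.ResolutionOfSingularities.Theses.SectionAscent.FibrewiseClosedPoints)
    (n : ℕ) : Rung n := by
  intro p hp K _ _ A _ _ _ _ hdim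
  have hlt : ringKrullDim A < ((n + 1 : ℕ) : WithBot ℕ∞) := by
    rw [hdim]
    exact_mod_cast Nat.lt_succ_self n
  exact (fibrewiseClosedPoints_iff_oneShotAffine.mp h) p hp (n + 1) K A hlt

/-- **On-path, the rung: `FibrewiseClosedPoints → AffineFourfolds`.** [folklore] -/
theorem affineFourfolds_of_crux
    (h : Summit.ResolutionOfSingularities.ResolutionOfSingularities.Theses.SectionAscent.FibrewiseClosedPoints) :
    AffineFourfolds :=
  rung_of_crux h 4

/-! ## The stub STATEMENTS by name (`Sig.stub_<name>`; `FibrewiseClosedPoints_of` takes exactly these)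

The stubs below the fold are registered with UNFOLDED signatures (tree vocabulary only), so that each
can be landed verbatim from a `Theorems/` file; `Sig.stub_*` are the same statements as named
propositions (definitional unfolding). -/

/-- Statement of `stub_printedThreefolds` (vendored printed facts of the floor). -/
def Sig.stub_printedThreefolds : Prop :=
  CossartPiltant2019AffineOneBlowup.{0} ∧ CossartPiltant2019Principalization.{0}

/-- Statement of `stub_surfacePrincipalization` (P₂, in print). -/
def Sig.stub_surfacePrincipalization : Prop :=
  ∀ (K : Type) [Field K], PrincipalizationDim K 2

/-- Statement of `stub_strongResolutionFourfolds` (R₄, OPEN — rung core). -/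
def Sig.stub_strongResolutionFourfolds : Prop :=
  ∀ p : ℕ, p.Prime → ∀ (K : Type) [Field K] [CharP K p], StrongBlowupFormDim K 4

/-- Statement of `stub_principalizationFourfolds` (P₄, OPEN — rung core). -/
def Sig.stub_principalizationFourfolds : Prop :=
  ∀ p : ℕ, p.Prime → ∀ (K : Type) [Field K] [CharP K p], PrincipalizationDim K 4

/-- Statement of `stub_dimensionFiveAndUp` (the GAP above the rung: all higher levels). -/
def Sig.stub_dimensionFiveAndUp : Prop :=
  ∀ n : ℕ, 5 ≤ n → Rung n

/-! ## The composition: stubs → crux, by name -/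

/-- **All levels from the stub statements.** [folklore] -/
theorem rung_all
    (h3 : CossartPiltant2019AffineOneBlowup.{0} ∧ CossartPiltant2019Principalization.{0})
    (hP2 : ∀ (K : Type) [Field K], PrincipalizationDim K 2)
    (hR4 : ∀ p : ℕ, p.Prime → ∀ (K : Type) [Field K] [CharP K p], StrongBlowupFormDim K 4)
    (hP4 : ∀ p : ℕ, p.Prime → ∀ (K : Type) [Field K] [CharP K p], PrincipalizationDim K 4)
    (h5 : ∀ n : ℕ, 5 ≤ n → Rung n) (n : ℕ) : Rung n := by
  rcases (show n ≤ 3 ∨ n = 4 ∨ 5 ≤ n by omega) with hle | rfl | hge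
  · exact rung_of_le_three h3 hP2 n hle
  · exact affineFourfolds_of hR4 hP4
  · exact h5 n hge

/-- The composition with UNFOLDED hypotheses, concluding the TARGET form `OneShotAffine`
(kept separate so that exactly the `Sig`-typed theorem below concludes the crux by name). [folklore] -/
theorem oneShotAffine_of_unfolded
    (h3 : CossartPiltant2019AffineOneBlowup.{0} ∧ CossartPiltant2019Principalization.{0})
    (hP2 : ∀ (K : Type) [Field K], PrincipalizationDim K 2)
    (hR4 : ∀ p : ℕ, p.Prime → ∀ (K : Type) [Field K] [CharP K p], StrongBlowupFormDim K 4)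
    (hP4 : ∀ p : ℕ, p.Prime → ∀ (K : Type) [Field K] [CharP K p], PrincipalizationDim K 4)
    (h5 : ∀ n : ℕ, 5 ≤ n → Rung n) : OneShotAffine := by
  intro p hp d K _ _ A _ _ _ _ _
  obtain ⟨n, hn, -⟩ := exists_ringKrullDim_eq_and_trdeg_eq K A
  exact rung_all h3 hP2 hR4 hP4 h5 n p hp K A hn

/-- **COMPOSITION (kernel-checked, no sorry): the five stub statements, BY NAME, imply the crux
`SectionAscent.FibrewiseClosedPoints` BY NAME** — through the target form
(`fibrewiseClosedPoints_iff_oneShotAffine`, landed in `Negative/LoadBearing`) and the finiteness of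
the dimension of an affine domain (`exists_ringKrullDim_eq_and_trdeg_eq`). [folklore] -/
theorem FibrewiseClosedPoints_of :
    Sig.stub_printedThreefolds → Sig.stub_surfacePrincipalization →
    Sig.stub_strongResolutionFourfolds → Sig.stub_principalizationFourfolds →
    Sig.stub_dimensionFiveAndUp →
    Summit.ResolutionOfSingularities.ResolutionOfSingularities.Theses.SectionAscent.FibrewiseClosedPoints := by
  intro h3 hP2 hR4 hP4 h5
  rw [fibrewiseClosedPoints_iff_oneShotAffine]
  exact oneShotAffine_of_unfolded h3 hP2 hR4 hP4 h5

/-- The stubs prove their `Sig` statements (definitional unfolding). [folklore] -/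
theorem sig1 : Sig.stub_printedThreefolds := stub_printedThreefolds
/-- [folklore] -/
theorem sig2 : Sig.stub_surfacePrincipalization := fun K _ => stub_surfacePrincipalization K
/-- [folklore] -/
theorem sig3 : Sig.stub_strongResolutionFourfolds :=
  fun p hp K _ _ => stub_strongResolutionFourfolds p hp K
/-- [folklore] -/
theorem sig4 : Sig.stub_principalizationFourfolds :=
  fun p hp K _ _ => stub_principalizationFourfolds p hp K
/-- [folklore] -/
theorem sig5 : Sig.stub_dimensionFiveAndUp := stub_dimensionFiveAndUp

/-- **The crux assembled from the registered stubs** (the only `sorry`s in its closure are the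
stubs'). [folklore] -/
theorem FibrewiseClosedPoints_proof :
    Summit.ResolutionOfSingularities.ResolutionOfSingularities.Theses.SectionAscent.FibrewiseClosedPoints :=
  FibrewiseClosedPoints_of sig1 sig2 sig3 sig4 sig5

end Summit.ResolutionOfSingularities.ResolutionOfSingularities.Cruxes.FibrewiseClosedPoints.DimensionLadder

end
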